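import Summits.Ventures.CertifiedManyBodySolver.Observables.SourcedGibbsTrialCapHFBCS
import Summits.Ventures.CertifiedManyBodySolver.Rows.SourcedTorusRows
import Summits.Ventures.CertifiedManyBodySolver.Observables.SourcedOrderParameterFloor
import HarnessLib

/-!
# The Hartree–Fock–BCS sourced cap in ROW vocabulary: a certified one-body number is an energy CEILING cell
# `SourcedTorusEnergyUpperRow L 0 U μ h e` of the pinned torus

HONEST FRAMING: zero compute; glue only; no number is claimed. The cap `groundEnergy_dWaveSourceTorus_le_HFBCS`
(`Observables/SourcedGibbsTrialCapHFBCS.lean`) bounds the interacting pinned ground energy `E₀(dWaveSourceTorus L U μ h)`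
by the explicit one-body functional `Φ_L(β, μ')` of the Nambu Fermi matrix of the FREE pinned torus; this file reads a
certified inequality `Φ_L(β, μ') ≤ e·L²` (the pilots' interval-arithmetic product, cell `hubbard-cq` W4 leg B′1) as the
energy CEILING cell `SourcedTorusEnergyUpperRow L 0 U μ h e` of `Rows/SourcedTorusRows.lean` (hubbard-cq-obsth-1), i.e.
the slot consumed — together with a sourced LOWER cell at a smaller field — by the finite-torus response FLOOR nodes
(hubbard-obs-pin-1 `PinningFieldChords`, hubbard-cq-obsth-3 `SourcedOrderParameterFloor.dWaveSourceDensity_ge_of_energy_window`,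
this seat's `PinningFieldResponseBracket`). Uniform-in-`L` form included. Not a statement about order of the
source-free model; not a superconductivity verdict.

Cell `hubbard-obs` (D-0042 / D-0082 (c-2)), seat `hubbard-obs-pin-2` (`prover-hubbard-obs-pin-2-g0-0`).

References: V. Bach, E. H. Lieb, J. P. Solovej, J. Stat. Phys. 76 (1994) 3, §2 [BachLiebSolovej1994]; T. Koma, H. Tasaki,
J. Stat. Phys. 76 (1994) 745, §1 [KomaTasaki1994].
-/

noncomputable section

namespace Summit.Ventures.CertifiedManyBodySolver.Observables

open Matrix Literature.MathematicalPhysics.QuantumLattice Literature.Probability.LatticeModels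
open Literature.MathematicalPhysics.QuantumLattice.HubbardWave0
open scoped ComplexOrder BigOperators

/-- **HF–BCS cap ⇒ energy CEILING cell.** If the one-body functional of `groundEnergy_dWaveSourceTorus_le_HFBCS` at
trial parameters `(β, μ')` is certified to be `≤ e·L²`, then `SourcedTorusEnergyUpperRow L 0 U μ h e`
(`E₀(dWaveSourceTorusTT' L 0 U μ h) ≤ e·L²`). [cite: BachLiebSolovej1994, §2] -/
theorem sourcedTorusEnergyUpperRow_of_HFBCS (L : ℕ) [NeZero L] (U μ μ' h β : ℝ) {e : ℚ}
    (hΦ : ((∑ i : Orb (FermionTorus 2 L), ∑ j : Orb (FermionTorus 2 L),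
          (bdgNambuMatrix
              (fun x y => if (fermionTorusGraph 2 L).Adj x y then -(1 : ℂ) else 0)
              (fun u v : FermionTorus 2 L => -(h : ℂ) * ∑ i : Fin 2,
                if v = FermionTorus.ofTorusSite (u.toTorusSite + Pi.single i 1) then
                  ((Real.sqrt 2 * (if i = 0 then 1 else -1) : ℝ) : ℂ) else 0) μ') i j *
            (1 + NormedSpace.exp ((β : ℂ) • bdgNambuMatrix
              (fun x y => if (fermionTorusGraph 2 L).Adj x y then -(1 : ℂ) else 0)
              (fun u v : FermionTorus 2 L => -(h : ℂ) * ∑ i : Fin 2,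
                if v = FermionTorus.ofTorusSite (u.toTorusSite + Pi.single i 1) then
                  ((Real.sqrt 2 * (if i = 0 then 1 else -1) : ℝ) : ℂ) else 0) μ'))⁻¹ j i) -
          (μ' : ℂ) * (L : ℂ) ^ 2).re +
        (μ' - μ) * (∑ x : FermionTorus 2 L,
          ((1 + NormedSpace.exp ((β : ℂ) • bdgNambuMatrix
              (fun x y => if (fermionTorusGraph 2 L).Adj x y then -(1 : ℂ) else 0)
              (fun u v : FermionTorus 2 L => -(h : ℂ) * ∑ i : Fin 2,
                if v = FermionTorus.ofTorusSite (u.toTorusSite + Pi.single i 1) then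
                  ((Real.sqrt 2 * (if i = 0 then 1 else -1) : ℝ) : ℂ) else 0) μ'))⁻¹ (orb x 0) (orb x 0) +
            (1 - (1 + NormedSpace.exp ((β : ℂ) • bdgNambuMatrix
              (fun x y => if (fermionTorusGraph 2 L).Adj x y then -(1 : ℂ) else 0)
              (fun u v : FermionTorus 2 L => -(h : ℂ) * ∑ i : Fin 2,
                if v = FermionTorus.ofTorusSite (u.toTorusSite + Pi.single i 1) then
                  ((Real.sqrt 2 * (if i = 0 then 1 else -1) : ℝ) : ℂ) else 0) μ'))⁻¹ (orb x 1) (orb x 1)))).re +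
        U * (∑ x : FermionTorus 2 L,
          ((1 + NormedSpace.exp ((β : ℂ) • bdgNambuMatrix
              (fun x y => if (fermionTorusGraph 2 L).Adj x y then -(1 : ℂ) else 0)
              (fun u v : FermionTorus 2 L => -(h : ℂ) * ∑ i : Fin 2,
                if v = FermionTorus.ofTorusSite (u.toTorusSite + Pi.single i 1) then
                  ((Real.sqrt 2 * (if i = 0 then 1 else -1) : ℝ) : ℂ) else 0) μ'))⁻¹ (orb x 0) (orb x 0) *
              (1 - (1 + NormedSpace.exp ((β : ℂ) • bdgNambuMatrix
              (fun x y => if (fermionTorusGraph 2 L).Adj x y then -(1 : ℂ) else 0)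
              (fun u v : FermionTorus 2 L => -(h : ℂ) * ∑ i : Fin 2,
                if v = FermionTorus.ofTorusSite (u.toTorusSite + Pi.single i 1) then
                  ((Real.sqrt 2 * (if i = 0 then 1 else -1) : ℝ) : ℂ) else 0) μ'))⁻¹ (orb x 1) (orb x 1)) +
            (1 + NormedSpace.exp ((β : ℂ) • bdgNambuMatrix
              (fun x y => if (fermionTorusGraph 2 L).Adj x y then -(1 : ℂ) else 0)
              (fun u v : FermionTorus 2 L => -(h : ℂ) * ∑ i : Fin 2,
                if v = FermionTorus.ofTorusSite (u.toTorusSite + Pi.single i 1) then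
                  ((Real.sqrt 2 * (if i = 0 then 1 else -1) : ℝ) : ℂ) else 0) μ'))⁻¹ (orb x 1) (orb x 0) *
              (1 + NormedSpace.exp ((β : ℂ) • bdgNambuMatrix
              (fun x y => if (fermionTorusGraph 2 L).Adj x y then -(1 : ℂ) else 0)
              (fun u v : FermionTorus 2 L => -(h : ℂ) * ∑ i : Fin 2,
                if v = FermionTorus.ofTorusSite (u.toTorusSite + Pi.single i 1) then
                  ((Real.sqrt 2 * (if i = 0 then 1 else -1) : ℝ) : ℂ) else 0) μ'))⁻¹ (orb x 0) (orb x 1))).re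
      ≤ ((e : ℚ) : ℝ) * (L : ℝ) ^ 2) :
    SourcedTorusEnergyUpperRow L 0 U μ h e := by
  have hcap := (groundEnergy_dWaveSourceTorus_le_HFBCS L U μ μ' h β).trans hΦ
  unfold SourcedTorusEnergyUpperRow
  rw [dWaveSourceTorusTT'_zero_tp]
  -- `Rows/SourcedTorusRows` compares torus sites through the linear order (a local `DecidableEq` instance there);
  -- the library instance used here agrees with it (`Subsingleton`), bridged by `convert`
  refine le_trans (le_of_eq ?_) hcap
  -- the two `DecidableEq (FermionTorus 2 L)` paths inside `Matrix.groundEnergy` agree (`Subsingleton`)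
  congr 1

/-- **Reading rule (finite torus, tree units).** A sourced LOWER cell `SourcedTorusEnergyLowerRow L 0 U μ h₁ ℓ` at a
smaller field `h₁ < h` (pilot certificate) and the HF–BCS CEILING cell `SourcedTorusEnergyUpperRow L 0 U μ h e` give
the finite-torus response FLOOR `(ℓ − e)/(2(h − h₁)) ≤ m_L(h) = dWaveSourceDensity L U μ h`
(hubbard-cq-obsth-3's `dWaveSourceDensity_ge_of_energy_window`). [cite: KomaTasaki1994, §1] -/
theorem dWaveSourceDensity_ge_of_rows (L : ℕ) [NeZero L] (U μ : ℝ) {h₁ h : ℝ} (hlt : h₁ < h) {ℓ e : ℚ}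
    (hlo : SourcedTorusEnergyLowerRow L 0 U μ h₁ ℓ) (hup : SourcedTorusEnergyUpperRow L 0 U μ h e) :
    (((ℓ : ℚ) : ℝ) - ((e : ℚ) : ℝ)) / (2 * (h - h₁)) ≤ dWaveSourceDensity L U μ h := by
  unfold SourcedTorusEnergyLowerRow at hlo
  unfold SourcedTorusEnergyUpperRow at hup
  rw [dWaveSourceTorusTT'_zero_tp] at hlo hup
  -- bridge the `DecidableEq (FermionTorus 2 L)` instance of the row cells to the library one (`Subsingleton`)
  have hlo' : ((ℓ : ℚ) : ℝ) * (L : ℝ) ^ 2 ≤ (dWaveSourceTorus L U μ h₁).groundEnergy := by convert hlo using 4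
  have hup' : (dWaveSourceTorus L U μ h).groundEnergy ≤ ((e : ℚ) : ℝ) * (L : ℝ) ^ 2 := by convert hup using 4
  exact dWaveSourceDensity_ge_of_energy_window L U μ hlt hlo' hup'

end Summit.Ventures.CertifiedManyBodySolver.Observables

end
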